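import Mathlib
import HarnessLib
import Literature.MathematicalPhysics.QuantumLattice.HeatKernelGroupGaugeProofs
import Summits.Ventures.LatticeQCDFlow.Exactness.GaugeEquivariance

/-!
# Abelian rung: layers that multiply active links by a gauge-invariant factor are gauge equivariant — the engine's U(1) LO Wilson-flow member and its booked log-det

HONEST FRAMING: exact (Metropolis-corrected) sampling algorithms for lattice gauge theory;
figures of merit are autocorrelation/cost numbers at stated couplings and volumes; no
continuum-physics claim.

Venture `LatticeQCDFlow` (cell pub-lqcd), topic `Exactness`; FANOUT row 14 (`eng-flowhmc`, engine
`latflow.fthmc`, family B; member `maps.u1_wilson_flow_lo`, twin `ref_u1`).  NEW WORK of the cell;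
nothing is cited as a fact; no number.  The `U(1)` companion of `SU2StapleFieldCovariance.lean` /
`SU2MaskedKickJacobianInvariance.lean`, and much simpler because the group is abelian:

* `plaquetteHolonomy_gaugeTransform_of_comm` — in a COMMUTATIVE group every plaquette holonomy is
  gauge INVARIANT (`g(x) P g(x)⁻¹ = P`); `isGaugeInvariant_plaquetteFeatures_of_comm`;
* **`isGaugeEquivariant_mul_of_invariant`** — any layer `V ↦ (e ↦ if p e then V e · u V e else V e)`
  whose factor `u` is gauge invariant at active links is `IsGaugeEquivariant` (any mask);
* **`isGaugeEquivariant_u1WilsonFlowLOSubstep`** — the engine's masked Euler sub-step of the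
  `U(1)` Wilson flow, `V(x,μ) ↦ V(x,μ) · exp(iε Z_{x,μ}(V))` with
  `Z = Σ_{ν ≠ μ} [Im P(x−ν̂,μ,ν) − Im P(x,μ,ν)]` (the forward map of
  `U1WilsonFlowLOSubstep.exists_measurableEquiv_u1WilsonFlowLOSubstep`, VERBATIM), is
  `IsGaugeEquivariant` — any colouring, any `ε`;
* **`isGaugeInvariant_u1WilsonFlowLOJacobian`** — its booked density
  `∏_active (1 − ε Σ_{ν ≠ μ} [Re P(x,μ,ν) + Re P(x−ν̂,μ,ν)])` (VERBATIM) is `IsGaugeInvariant`;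
* `isGaugeInvariant_u1_ftAction` — hence `S(F V) − log J(V)` is gauge invariant for every
  gauge-invariant `S` (`GaugeEquivariance.IsGaugeInvariant.comp_equivariant`).

NOT CLAIMED: the learned `U(1)` members (`u1_flow_trained`: NCP layers on plaquette angles — the
same argument applies once their typed form is restated on `GaugeConfig d L Circle`; not done
here); any number.
-/

noncomputable section

namespace Summit.Ventures.LatticeQCDFlow.Exactness

open Literature.MathematicalPhysics.QuantumFieldTheory

variable {d L : ℕ}

/-! ## Commutative groups: plaquettes are invariant, multiplicative layers are equivariant -/

section Comm

variable {G : Type*} [CommGroup G]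

/-- In a commutative group every plaquette holonomy is gauge invariant. -/
theorem plaquetteHolonomy_gaugeTransform_of_comm (g : Site d L → G) (V : GaugeConfig d L G)
    (x : Site d L) (i j : Fin d) :
    plaquetteHolonomy (gaugeTransform g V) x i j = plaquetteHolonomy V x i j := by
  rw [Literature.MathematicalPhysics.QuantumLattice.plaquetteHolonomy_gaugeTransform, mul_inv_cancel_comm]

/-- Any family of plaquette holonomies is a gauge-invariant feature map (commutative group). -/
theorem isGaugeInvariant_plaquetteFeatures_of_comm {I : Type*} (site : I → Site d L) (m k : I → Fin d) :
    IsGaugeInvariant (fun (V : GaugeConfig d L G) (i : I) => plaquetteHolonomy V (site i) (m i) (k i)) := by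
  intro g V
  funext i
  exact plaquetteHolonomy_gaugeTransform_of_comm g V (site i) (m i) (k i)

/-- **A layer multiplying each active link by a gauge-invariant factor is gauge equivariant**
(commutative group, any mask `p`). -/
theorem isGaugeEquivariant_mul_of_invariant (p : Edge d L → Prop) [DecidablePred p]
    (u : GaugeConfig d L G → Edge d L → G)
    (hu : ∀ (g : Site d L → G) (V : GaugeConfig d L G) (e : Edge d L), p e → u (gaugeTransform g V) e = u V e) :
    IsGaugeEquivariant (fun (V : GaugeConfig d L G) (e : Edge d L) => if p e then V e * u V e else V e) := by
  intro g V
  funext e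
  by_cases he : p e
  · have hgt : ∀ (W : GaugeConfig d L G), gaugeTransform g W e = g e.1 * W e * (g (e.1.shift e.2))⁻¹ :=
      fun _ => rfl
    simp only [if_pos he, hgt, hu g V e he]
    simp only [mul_assoc, mul_comm (u V e)]
  · have hgt : ∀ (W : GaugeConfig d L G), gaugeTransform g W e = g e.1 * W e * (g (e.1.shift e.2))⁻¹ :=
      fun _ => rfl
    simp only [if_neg he, hgt]

end Comm

/-! ## The engine's `U(1)` LO member -/

section U1

variable {X : Type*} [DecidableEq X] (χ : Site d L → X)

/-- **The masked Euler sub-step of the `U(1)` Wilson flow is gauge equivariant** (its drift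
`Z_{x,μ}` is a function of plaquettes, which are invariant; `U(1)` is abelian). -/
theorem isGaugeEquivariant_u1WilsonFlowLOSubstep (μ : Fin d) (b : X) (ε : ℝ) :
    IsGaugeEquivariant (fun (V : GaugeConfig d L Circle) (e : Edge d L) => if e.2 = μ ∧ χ e.1 = b then
          V e * Circle.exp (ε * ∑ ν ∈ Finset.univ.erase e.2,
            (((plaquetteHolonomy V (e.1 - Pi.single ν 1) e.2 ν : Circle) : ℂ).im -
              ((plaquetteHolonomy V e.1 e.2 ν : Circle) : ℂ).im)) else V e) :=
  isGaugeEquivariant_mul_of_invariant (fun e : Edge d L => e.2 = μ ∧ χ e.1 = b)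
    (fun (V : GaugeConfig d L Circle) (e : Edge d L) => Circle.exp (ε * ∑ ν ∈ Finset.univ.erase e.2,
      (((plaquetteHolonomy V (e.1 - Pi.single ν 1) e.2 ν : Circle) : ℂ).im -
        ((plaquetteHolonomy V e.1 e.2 ν : Circle) : ℂ).im)))
    (fun g V e _ => by simp only [plaquetteHolonomy_gaugeTransform_of_comm])

/-- **The booked density of the `U(1)` LO sub-step is gauge invariant** (a function of plaquettes). -/
theorem isGaugeInvariant_u1WilsonFlowLOJacobian [NeZero L] (μ : Fin d) (b : X) (ε : ℝ) :
    IsGaugeInvariant (fun V : GaugeConfig d L Circle => ∏ a : {e : Edge d L // e.2 = μ ∧ χ e.1 = b},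
          (1 - ε * ∑ ν ∈ Finset.univ.erase a.1.2,
            (((plaquetteHolonomy V a.1.1 a.1.2 ν : Circle) : ℂ).re +
              ((plaquetteHolonomy V (a.1.1 - Pi.single ν 1) a.1.2 ν : Circle) : ℂ).re))) := by
  intro g V
  simp only [plaquetteHolonomy_gaugeTransform_of_comm]

/-- **Hence the pulled-back action of the `U(1)` LO sub-step is gauge invariant** for every
gauge-invariant action `S`: `V ↦ S (F V) − log J(V)`. -/
theorem isGaugeInvariant_u1_ftAction [NeZero L] (μ : Fin d) (b : X) (ε : ℝ)
    {S : GaugeConfig d L Circle → ℝ} (hS : IsGaugeInvariant S) :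
    IsGaugeInvariant (fun V : GaugeConfig d L Circle =>
      S (fun (e : Edge d L) => if e.2 = μ ∧ χ e.1 = b then
          V e * Circle.exp (ε * ∑ ν ∈ Finset.univ.erase e.2,
            (((plaquetteHolonomy V (e.1 - Pi.single ν 1) e.2 ν : Circle) : ℂ).im -
              ((plaquetteHolonomy V e.1 e.2 ν : Circle) : ℂ).im)) else V e) -
      Real.log (∏ a : {e : Edge d L // e.2 = μ ∧ χ e.1 = b},
          (1 - ε * ∑ ν ∈ Finset.univ.erase a.1.2,
            (((plaquetteHolonomy V a.1.1 a.1.2 ν : Circle) : ℂ).re +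
              ((plaquetteHolonomy V (a.1.1 - Pi.single ν 1) a.1.2 ν : Circle) : ℂ).re)))) := by
  intro g V
  have hF := isGaugeEquivariant_u1WilsonFlowLOSubstep χ μ b ε g V
  have hJ := isGaugeInvariant_u1WilsonFlowLOJacobian χ μ b ε g V
  beta_reduce at hF hJ ⊢
  rw [hF, hS g, hJ]

end U1

end Summit.Ventures.LatticeQCDFlow.Exactness
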